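import Summits.Ventures.DiscreteObjects.Hadamard.ParityPermModule29

/-!
# Hadamard 668 census, family F12 — permutation modules: the dimension count with fixed points (kernel)

Framing: lottery ticket; floor = certified bounds/negative ranges.

Cell pub-namedobj (venture DiscreteObjects), target (H), hadamard gen 8.  `ParityPermModule29.finrank_ker_aeval_funLeft` computed
`dim ker f₁(T) = #classes · deg f₁` for the pull-back operator `T` of a FIXED-POINT-FREE permutation `τ` with `τ^p = 1`
(`f₁ f₂ = X^p - 1` coprime).  Here the fixed-point-free hypothesis is removed when `f₁(1) ≠ 0`
(`finrank_ker_aeval_funLeft_of_eval_ne_zero`): an element of `ker f₁(T)` vanishes at every fixed point of `τ`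
(`aeval_funLeft_apply_of_fixed`: there `f₁(T) u = f₁(1) u`), so restriction to the moved points `B' = {y // τ y ≠ y}` embeds
`ker f₁(T)` into the kernel for the fixed-point-free permutation `τ|B'`, which has the same classes
(`card_moved_eq : |B'| = #classes · p`).  Needed for Lander's parity theorem at primes `p` whose automorphisms DO have
fixed points (`p = 3, 5, 7, 11, 13, 37, 41` for the 2-(667,333,166) design).  Ours, not literature; no `sorry`.
-/

open Polynomial Finset BigOperators

namespace Summit.Ventures.DiscreteObjects.Hadamard

variable {F : Type*} [Field F] {B : Type*} [Fintype B] [DecidableEq B]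

omit [Fintype B] [DecidableEq B] in
/-- at a fixed point `y` of `τ`: `(g(T) u) y = g(1) · u y` -/
lemma aeval_funLeft_apply_of_fixed (τ : Equiv.Perm B) (g : F[X]) (u : B → F) {y : B} (hy : τ y = y) :
    aeval (LinearMap.funLeft F F τ) g u y = g.eval 1 * u y := by
  rw [aeval_funLeft_apply, eval_eq_sum_range, Finset.sum_mul]
  refine Finset.sum_congr rfl fun k _ => ?_
  rw [perm_pow_apply_of_fixed τ hy k, one_pow, mul_one]

/-- the number of moved points is `#classes · p` -/
lemma card_moved_eq (τ : Equiv.Perm B) {p : ℕ} (hp : p.Prime) (hτ : τ ^ p = 1) :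
    Fintype.card {y // τ y ≠ y} = (blockClasses τ p).card * p := by
  have h := card_fixed_add_classes τ hp hτ
  have hsplit : (univ.filter fun y => τ y = y).card + (univ.filter fun y => τ y ≠ y).card = Fintype.card B := by
    rw [← Finset.card_univ]
    exact Finset.card_filter_add_card_filter_not (fun y => τ y = y)
  rw [Fintype.card_subtype]
  omega

/-- **exact count with fixed points allowed**: if `f₁(1) ≠ 0` then `dim ker f₁(T) = #classes · deg f₁` -/
theorem finrank_ker_aeval_funLeft_of_eval_ne_zero (τ : Equiv.Perm B) {p : ℕ} (hp : p.Prime) (hτ : τ ^ p = 1)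
    {f₁ f₂ : F[X]} (hf : f₁ * f₂ = X ^ p - 1) (hcop : IsCoprime f₁ f₂) (h1 : f₁.eval 1 ≠ 0) :
    Module.finrank F (LinearMap.ker (aeval (LinearMap.funLeft F F τ) f₁)) = (blockClasses τ p).card * f₁.natDegree := by
  apply le_antisymm _ (card_mul_natDegree_le_finrank_ker τ hp hτ hf)
  -- the moved part and the induced fixed-point-free permutation
  have hpr : ∀ y, τ (τ y) ≠ τ y ↔ τ y ≠ y := fun y => τ.injective.ne_iff
  set τ' : Equiv.Perm {y // τ y ≠ y} := τ.subtypePerm hpr with hτ'def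
  have hτ' : τ' ^ p = 1 := by
    ext y
    simp [hτ'def, Equiv.Perm.subtypePerm_pow, hτ]
  have hfix' : (univ.filter fun y : {y // τ y ≠ y} => τ' y = y).card = 0 := by
    rw [Finset.card_eq_zero, Finset.filter_eq_empty_iff]
    intro y _ h
    exact y.2 (congrArg Subtype.val h)
  have hcard' : Fintype.card {y // τ y ≠ y} = (blockClasses τ' p).card * p := by
    have e := card_fixed_add_classes τ' hp hτ'
    rw [hfix', zero_add] at e
    exact e.symm
  have hcc : (blockClasses τ' p).card = (blockClasses τ p).card := by
    have e1 := card_moved_eq τ hp hτ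
    rw [hcard'] at e1
    exact Nat.eq_of_mul_eq_mul_right hp.pos e1
  have hdim' := finrank_ker_aeval_funLeft τ' hp hτ' hf hcop hcard'
  -- restriction to the moved points intertwines the two pull-back operators
  set R : (B → F) →ₗ[F] ({y // τ y ≠ y} → F) := LinearMap.funLeft F F (Subtype.val : {y // τ y ≠ y} → B) with hR
  have hRT : R ∘ₗ LinearMap.funLeft F F τ = LinearMap.funLeft F F τ' ∘ₗ R :=
    LinearMap.ext fun w => funext fun y => rfl
  set K := LinearMap.ker (aeval (LinearMap.funLeft F F τ) f₁) with hK
  set K' := LinearMap.ker (aeval (LinearMap.funLeft F F τ') f₁) with hK'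
  have hmem : ∀ w ∈ K, R w ∈ K' := by
    intro w hw
    rw [LinearMap.mem_ker] at hw ⊢
    rw [← aeval_apply_of_comp_eq _ _ R hRT f₁ w, hw, map_zero]
  -- elements of K vanish at fixed points
  have hvan : ∀ w ∈ K, ∀ y, τ y = y → w y = 0 := by
    intro w hw y hy
    have e := congrFun (LinearMap.mem_ker.mp hw) y
    rw [aeval_funLeft_apply_of_fixed τ f₁ w hy, Pi.zero_apply] at e
    exact (mul_eq_zero.mp e).resolve_left h1
  -- the induced map K → K' is injective
  let φ : K →ₗ[F] K' := (R.domRestrict K).codRestrict K' (fun w => hmem w.1 w.2)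
  have hφ : Function.Injective φ := by
    intro w w' hww'
    have e : R w.1 = R w'.1 := congrArg Subtype.val hww'
    apply Subtype.ext
    funext y
    by_cases hy : τ y = y
    · rw [hvan w.1 w.2 y hy, hvan w'.1 w'.2 y hy]
    · exact congrFun e ⟨y, hy⟩
  calc Module.finrank F K ≤ Module.finrank F K' := LinearMap.finrank_le_finrank_of_injective hφ
    _ = (blockClasses τ p).card * f₁.natDegree := by rw [hdim', hcc]

end Summit.Ventures.DiscreteObjects.Hadamard
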